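import Mathlib

/-!
# Rectangle cliques for theta-body kernels on block pairs

Crux `stmt-MatrixMultiplication-14309` (`FourierTwoFamiliesModP.PrimeCyclicPowerGain`), line
`clique-coclique-direct-sum-clique`, milestone 4 of the bet `stub_thetaBound`; closes the registered milestone
stub `stub_thetaRectangleClique` (drefute's lever F2, "rectangle cliques", in kernel form).

Setting: an additive commutative group `G`, vertices `v = (v.1, v.2)` ("block pairs") in `Finset G × Finset G`,
a forbidden difference set `X₀ : Finset G`, and a kernel `B : V → V → ℝ` whose nonzero entries sit on pairs of
vertices that are either EQUAL or COMPATIBLE, compatibility meaning that both cross-difference sets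
`v.1 − w.2` and `w.1 − v.2` avoid `X₀`.

Claim (`entry_eq_zero_of_rectangle`, `stub_thetaRectangleClique`): if `P − Q ⊆ X₀` then for two DISTINCT
vertices `v ≠ w` with `v.1 ∩ P ≠ ∅` and `w.2 ∩ Q ≠ ∅` the entry `B v w` vanishes.  Indeed, were `B v w ≠ 0`,
the support hypothesis with `v ≠ w` would give `Disjoint (v.1 − w.2) X₀`; but `a ∈ v.1 ∩ P`, `b ∈ w.2 ∩ Q`
produce `a − b ∈ v.1 − w.2` and `a − b ∈ P − Q ⊆ X₀`.  In words: the vertices meeting the "rectangle"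
`P × Q` form a clique of the conflict graph, so a kernel supported on the compatibility graph vanishes across
two distinct such vertices.
-/

namespace Summit.MatrixMultiplication.MatrixMultiplication.Theorems.PrimeCyclicPowerGainTheta.Rectangle

open scoped BigOperators Pointwise

variable {G : Type*} [AddCommGroup G] [DecidableEq G]

/-- **Rectangle incompatibility.**  If `P − Q ⊆ X₀`, `v.1` meets `P` and `w.2` meets `Q`, then the
cross-difference set `v.1 − w.2` meets `X₀`, i.e. it is NOT disjoint from `X₀`. -/
theorem not_disjoint_of_rectangle (X₀ P Q : Finset G) (hPQ : P - Q ⊆ X₀) (v w : Finset G × Finset G)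
    (hv : (v.1 ∩ P).Nonempty) (hw : (w.2 ∩ Q).Nonempty) : ¬ Disjoint (v.1 - w.2) X₀ := by
  obtain ⟨a, ha⟩ := hv
  obtain ⟨b, hb⟩ := hw
  rw [Finset.mem_inter] at ha hb
  intro hdis
  exact Finset.disjoint_left.1 hdis (Finset.sub_mem_sub ha.1 hb.1) (hPQ (Finset.sub_mem_sub ha.2 hb.2))

/-- **Rectangle clique, kernel form.**  Let `B` be a kernel on block pairs whose nonzero entries `B v w ≠ 0`
sit on pairs that are equal or compatible (`Disjoint (v.1 − w.2) X₀ ∧ Disjoint (w.1 − v.2) X₀`).  If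
`P − Q ⊆ X₀`, then `B v w = 0` for any two distinct vertices with `v.1 ∩ P ≠ ∅` and `w.2 ∩ Q ≠ ∅`. -/
theorem entry_eq_zero_of_rectangle (X₀ P Q : Finset G) (hPQ : P - Q ⊆ X₀)
    (B : Finset G × Finset G → Finset G × Finset G → ℝ)
    (hsupp : ∀ v w : Finset G × Finset G, B v w ≠ 0 →
      v = w ∨ (Disjoint (v.1 - w.2) X₀ ∧ Disjoint (w.1 - v.2) X₀))
    (v w : Finset G × Finset G) (hvw : v ≠ w) (hv : (v.1 ∩ P).Nonempty) (hw : (w.2 ∩ Q).Nonempty) :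
    B v w = 0 := by
  by_contra hB
  rcases hsupp v w hB with h | ⟨hdis, _⟩
  · exact hvw h
  · exact not_disjoint_of_rectangle X₀ P Q hPQ v w hv hw hdis

/-- **Registered milestone stub `stub_thetaRectangleClique`** (crux stmt-MatrixMultiplication-14309, line
clique-coclique-direct-sum-clique; milestone 4 of the bet `stub_thetaBound`; drefute's lever F2 "rectangle
cliques" in kernel form, over any additive commutative group).  If `P − Q ⊆ X₀` then two DISTINCT vertices of the
support of `B`, one meeting `P` on its `A`-side and the other meeting `Q` on its `B`-side, are incompatible, so
the kernel vanishes on the pair.  Only the compatibility clause of the support hypothesis is used; the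
cardinality, directness (W) and `A − B ⊆ X₀` clauses are carried for uniformity with the sibling stubs. -/
theorem stub_thetaRectangleClique :
    ∀ (G : Type) [AddCommGroup G] [DecidableEq G] (s : ℕ) (X₀ P Q : Finset G)
      (B : Finset G × Finset G → Finset G × Finset G → ℝ),
      P - Q ⊆ X₀ →
      (∀ v w : Finset G × Finset G, B v w ≠ 0 →
        (v.1.card = s ∧ v.2.card = s ∧
          (∀ a ∈ v.1, ∀ a' ∈ v.1, ∀ b ∈ v.2, ∀ b' ∈ v.2, (a - a') + (b - b') = 0 → a = a' ∧ b = b') ∧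
          v.1 - v.2 ⊆ X₀) ∧
        (w.1.card = s ∧ w.2.card = s ∧
          (∀ a ∈ w.1, ∀ a' ∈ w.1, ∀ b ∈ w.2, ∀ b' ∈ w.2, (a - a') + (b - b') = 0 → a = a' ∧ b = b') ∧
          w.1 - w.2 ⊆ X₀) ∧
        (v = w ∨ (Disjoint (v.1 - w.2) X₀ ∧ Disjoint (w.1 - v.2) X₀))) →
      ∀ v w : Finset G × Finset G, v ≠ w → (v.1 ∩ P).Nonempty → (w.2 ∩ Q).Nonempty → B v w = 0 :=
  fun G _ _ _ X₀ P Q B hPQ hsupp v w hvw hv hw =>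
    entry_eq_zero_of_rectangle (G := G) X₀ P Q hPQ B (fun v' w' hB => (hsupp v' w' hB).2.2) v w hvw hv hw

end Summit.MatrixMultiplication.MatrixMultiplication.Theorems.PrimeCyclicPowerGainTheta.Rectangle
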